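import Literature.Dynamics.Hyperbolic.HyperbolicSemiflowModel
import Summits.AnomalousDissipation.AnomalousDissipation.Theorems.BaireTransferDenseLoudDesignerForcesErgodicLine
import HarnessLib
import Mathlib.MeasureTheory.Measure.SeparableMeasure

/-!
# The closing lemma for hyperbolic measures of `C²` local semiflows on Hilbert spaces — standalone statement of stub D

Lead c13-0 of crux stmt-AnomalousDissipation-1143 (`BaireTransfer.DenseLoudDesignerForces`), line
`ergodic-budget-selection-closing`.  This file TYPES the registered stub D (`stub_ambientClosing`) as a Literature-grade
statement over a general separable real Hilbert space (`AmbientClosingOnHilbert`) and proves that it specialises to the stub's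
registered shape at the Navier–Stokes phase space `Hsp` (`ambientClosing_Hsp_of_hilbert`), so that a planner can promote D to a
Literature theorem item (`Literature/Dynamics/Hyperbolic/`) with no Navier–Stokes vocabulary.  Nothing is asserted: one `def … : Prop`,
one implication.  Sources of the theorem itself: A. Katok, Publ. IHÉS 51 (1980) §3 Main Lemma (finite dimension);
Z. Lian, L.-S. Young, JAMS 25 (2012) (semiflows on Hilbert spaces); L. Barreira, Ya. Pesin (2023) §11.2.
-/

set_option linter.dupNamespace false

noncomputable section

open MeasureTheory
open scoped ENNReal

namespace Summit.AnomalousDissipation.AnomalousDissipation.Cruxes.DenseLoudDesignerForces.AmbientClosingItem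

open Literature.Dynamics.Hyperbolic
open Summit.AnomalousDissipation.AnomalousDissipation.Theorems.DenseLoudDesignerForces.Ergodic

/-- **Closing lemma for hyperbolic invariant measures of `C²` local semiflows on a separable real Hilbert space** (the
statement of stub D of line `ergodic-budget-selection-closing`, over a general phase space): every `C²` local semiflow model
`(U, Λ, g, m)` in the sense of `IsHyperbolicSemiflowModel` (compact invariant `Λ`, injective time-`t` maps with compact injective
derivatives, `m` an invariant Borel probability measure on `Λ` with no zero Lyapunov exponent except the flow direction) has the
ambient Katok closing property along compact Pesin sets `HasAmbientClosing U Λ g m`.  Katok 1980 §3 (finite dimension);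
Lian–Young 2012 (Hilbert space).  Item-sized: multiplicative ergodic theorem + Lyapunov charts + closing. -/
def AmbientClosingOnHilbert : Prop :=
  ∀ (E : Type) [NormedAddCommGroup E] [InnerProductSpace ℝ E] [CompleteSpace E] [SecondCountableTopology E]
    [MeasurableSpace E] [BorelSpace E] (U Λ : Set E) (g : ℝ → E → E) (m : Measure E),
    IsHyperbolicSemiflowModel U Λ g m → HasAmbientClosing U Λ g m

/-- **Specialisation to the Navier–Stokes phase space**: `AmbientClosingOnHilbert` gives stub D verbatim at `E = Hsp`
(`Hsp = ↥(Torus.energySpace (Fin 3))`, a closed subspace of `L²(T³; ℝ³)` with its Borel σ-algebra). -/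
theorem ambientClosing_Hsp_of_hilbert (h : AmbientClosingOnHilbert) {U Λ : Set Hsp} {g : ℝ → Hsp → Hsp}
    {m : Measure Hsp} (hm : IsHyperbolicSemiflowModel U Λ g m) : HasAmbientClosing U Λ g m := by
  -- `Hsp` is second countable: a subspace of the separable `L²(T³; ℝ³)` (Mathlib's `Lp.SecondCountableTopology`,
  -- exponent hypothesis `2 ≠ ∞` as a `Fact`); the instances are kept local to this proof.
  haveI : Fact ((2 : ℝ≥0∞) ≠ ∞) := ⟨ENNReal.ofNat_ne_top⟩
  haveI : SecondCountableTopology Hsp := TopologicalSpace.Subtype.secondCountableTopology _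
  exact h Hsp U Λ g m hm

end Summit.AnomalousDissipation.AnomalousDissipation.Cruxes.DenseLoudDesignerForces.AmbientClosingItem

end
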